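import Mathlib.LinearAlgebra.FiniteDimensional.Lemmas
import Mathlib.LinearAlgebra.Quotient.Basic
import HarnessLib

/-!
# Venture HSemireg — kernel index of the linear algebra of THEOREM U (W5 seat w5-n6-2 gen 16)

Bookkeeping of the computation cell `pub-hsemireg`, group W5 (note
`widen/W5/UNIVERSAL-w5n62g16.md` v1.1, scripts `widen/W5/n6code2/v19/`). THEOREM U bounds from below
the number of first-order classes carried by the union `U′ = {16 cross slots} ∪ {long slot}` of a
placement on the Koszul frame of a ppav₆, INDEPENDENTLY of the Maurer–Cartan point, by two elementary
dimension counts on a five-term complex `C⁻¹ → C⁰ →Φ″ C¹_{U′} →Φ′ C² → C³`: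

* LEMMA 3 (`finrank_le_finrank_ker_add`): if a subspace `Z′ ≤ C¹` is mapped by `Φ′` into `T′ ≤ C²`
  then `dim Z′ ≤ dim ker Φ′ + dim T′` (the obstruction equations are dependent through `C³`);
* LEMMA 4 (`finrank_sup_range_add_le`, `finrank_range_le_finrank_ker`): if `R : H → C¹` maps a
  subspace `I ≤ H` into `V₁` then `dim (V₁ + range R) + dim I ≤ dim V₁ + dim H` — the OVERLAP of the two
  gauge images; and the feed `ψ : H_k → C⁰` with `range ψ ≤ ker Φ″`, `ker ψ ≤ ker σ` gives
  `dim range σ ≤ dim ker Φ″`;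
* the CLASS COUNT (`classes_lower_bound`): the image of `ker Φ′` in `C¹ ⧸ B¹` has dimension at least
  `dim Z′ − dim T′ − (dim C⁰ − i) − dim T_U` whenever `ker Φ′ ⊓ B¹ ≤ range Φ″ ⊔ T_U` and `i ≤ dim ker Φ″`;
* §2: the g = 6 constants of the note (`hom(S_r, O(mΘ))` against its closed forms, `dim Kos =
  6·3⁶ − 4`, `dim I = 4·5⁶ − dim Kos`) and the four resulting bounds
  `92 173 ∕ 117 073 ∕ 48 098 ∕ 17 169 > 0`, by `norm_num`.

HONEST FRAMING: abstract finite-dimensional linear algebra over a field + integer arithmetic only. The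
identification of `Φ′, Φ″, Z′, T′, I, ψ, σ` with the slot data of the 81 residue shapes (the slot ∕ gauge
∕ obstruction inventory, the two Maurer–Cartan equations `Σ u_j t′_j = 0`, `c u_j = 0`, and the closed
forms for `hom(S_r, O(mΘ))`, `dim Kos`) lives in the note, not here. Nothing in this file says that HC,
HC_CM or HC_AV holds; no door ∕ tier ∕ report sentence of the cell is a consequence of this file alone.
-/

namespace Summit.Ventures.HSemireg

namespace UnionSlotCount

open Module

section LinearAlgebra

variable {K : Type*} [Field K]
variable {C₀ C₁ C₂ H P : Type*}
  [AddCommGroup C₀] [Module K C₀] [AddCommGroup C₁] [Module K C₁] [AddCommGroup C₂] [Module K C₂]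
  [AddCommGroup H] [Module K H] [AddCommGroup P] [Module K P]

/-- The kernel of a restriction injects into the kernel: `dim ker (Φ|_Z) ≤ dim ker Φ`. -/
theorem finrank_ker_domRestrict_le [FiniteDimensional K C₁] (Φ : C₁ →ₗ[K] C₂) (Z : Submodule K C₁) :
    finrank K (LinearMap.ker (Φ.domRestrict Z)) ≤ finrank K (LinearMap.ker Φ) := by
  have hcomap : LinearMap.ker (Φ.domRestrict Z) = Submodule.comap Z.subtype (LinearMap.ker Φ) := by
    ext ⟨u, hu⟩
    simp [LinearMap.mem_ker]
  rw [hcomap, ← Submodule.finrank_map_subtype_eq Z (Submodule.comap Z.subtype (LinearMap.ker Φ))]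
  exact Submodule.finrank_mono (Submodule.map_comap_le _ _)

/-- **LEMMA 3 (abstract).** If `Φ′` maps the subspace `Z′` into `T′`, then
`dim Z′ ≤ dim ker Φ′ + dim T′`. In the note: `Z′ = 𝒵 ⊕ Hom(C,A′)`, `T′ = Hom(S₄, A′)` (the eight
obstruction families are dependent through the degree-3 slot `Hom(A,A′)`), giving
`dim ker Φ′ ≥ 312 380 + 531 441 − 221 532 = 622 289`. -/
theorem finrank_le_finrank_ker_add [FiniteDimensional K C₁] [FiniteDimensional K C₂]
    (Φ : C₁ →ₗ[K] C₂) (Z : Submodule K C₁) (T : Submodule K C₂) (h : Z.map Φ ≤ T) :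
    finrank K Z ≤ finrank K (LinearMap.ker Φ) + finrank K T := by
  have h1 := LinearMap.finrank_range_add_finrank_ker (Φ.domRestrict Z)
  have h2 : finrank K (LinearMap.range (Φ.domRestrict Z)) ≤ finrank K T := by
    rw [LinearMap.range_domRestrict]
    exact Submodule.finrank_mono h
  have h3 := finrank_ker_domRestrict_le Φ Z
  omega

/-- **LEMMA 4 (abstract, the overlap).** If `R : H → C₁` maps `I ≤ H` into `V₁`, then
`dim (V₁ ⊔ range R) + dim I ≤ dim V₁ + dim H`. In the note: `R = (· ∘ c)` on `H = Hom(C′,A′)`,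
`I = Σ_k t_k·Hom(C′,B′_k)` (dimension `58 130`), `V₁ = Σ_k t_k·Hom(C∕𝒰, B′_k)`; the hypothesis
`R(I) ≤ V₁` is `(t_k h_k) c = t_k (h_k c)` with `(h_k c) u_j = h_k (c u_j) = 0`. -/
theorem finrank_sup_range_add_le [FiniteDimensional K C₁] [FiniteDimensional K H]
    (R : H →ₗ[K] C₁) (I : Submodule K H) (V₁ : Submodule K C₁) (h : I.map R ≤ V₁) :
    finrank K ↥(V₁ ⊔ LinearMap.range R) + finrank K I ≤ finrank K V₁ + finrank K H := by
  have hsup := Submodule.finrank_sup_add_finrank_inf_eq V₁ (LinearMap.range R)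
  have hrn := LinearMap.finrank_range_add_finrank_ker R
  have hinf : I.map R ≤ V₁ ⊓ LinearMap.range R := le_inf h LinearMap.map_le_range
  have h4 : finrank K ↥(I.map R) ≤ finrank K ↥(V₁ ⊓ LinearMap.range R) := Submodule.finrank_mono hinf
  have h5 := finrank_le_finrank_ker_add R I (I.map R) le_rfl
  omega

/-- **LEMMA 4, kernel form** (the custodian's reading, bus l.21462): a feed `ψ : H_k → C₀` landing in
`ker Φ″` whose kernel is contained in the kernel of `σ : H_k → P` forces `dim range σ ≤ dim ker Φ″`.
In the note: `ψ(h) = ((h_k c)_k, Σ_k t_k h_k)`, `σ(h) = Σ_k t_k h_k`, `dim range σ = dim I = 58 130`,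
so `rank Φ″ ≤ 588 245 − 58 130 = 530 115` for EVERY centre `c`. -/
theorem finrank_range_le_finrank_ker [FiniteDimensional K H] [FiniteDimensional K C₀]
    (ψ : H →ₗ[K] C₀) (σ : H →ₗ[K] P) (Φ'' : C₀ →ₗ[K] C₁)
    (hrange : LinearMap.range ψ ≤ LinearMap.ker Φ'') (hker : LinearMap.ker ψ ≤ LinearMap.ker σ) :
    finrank K (LinearMap.range σ) ≤ finrank K (LinearMap.ker Φ'') := by
  have h1 := LinearMap.finrank_range_add_finrank_ker ψ
  have h2 := LinearMap.finrank_range_add_finrank_ker σ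
  have h3 : finrank K (LinearMap.ker ψ) ≤ finrank K (LinearMap.ker σ) := Submodule.finrank_mono hker
  have h4 : finrank K (LinearMap.range ψ) ≤ finrank K (LinearMap.ker Φ'') := Submodule.finrank_mono hrange
  omega

/-- The image of a subspace `Z` in the quotient `C₁ ⧸ B`: `dim Z ≤ dim (image of Z) + dim B_U`
whenever `Z ⊓ B ≤ B_U`. -/
theorem finrank_le_finrank_map_mkQ_add [FiniteDimensional K C₁] (Z B BU : Submodule K C₁)
    (h : Z ⊓ B ≤ BU) :
    finrank K Z ≤ finrank K ↥(Z.map B.mkQ) + finrank K BU := by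
  have h1 := LinearMap.finrank_range_add_finrank_ker (B.mkQ.domRestrict Z)
  rw [LinearMap.range_domRestrict] at h1
  have hker : LinearMap.ker (B.mkQ.domRestrict Z) = Submodule.comap Z.subtype B := by
    ext ⟨u, hu⟩
    simp
  have h2 : finrank K (LinearMap.ker (B.mkQ.domRestrict Z)) ≤ finrank K BU := by
    rw [hker, ← Submodule.finrank_map_subtype_eq Z (Submodule.comap Z.subtype B),
      Submodule.map_comap_subtype]
    exact Submodule.finrank_mono h
  omega

/-- **THE CLASS COUNT of THEOREM U (abstract).** Let `Φ″ : C₀ → C₁` (gauge feed into the union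
`U′`), `Φ′ : C₁ → C₂` (obstruction map on `U′`), `B ≤ C₁` the full coboundary space and `T_U` the
torus coboundaries supported on `U′`, with `ker Φ′ ⊓ B ≤ range Φ″ ⊔ T_U` (LEMMA 2 of the note). If
`Φ′(Z′) ≤ T′` (LEMMA 3) and `i ≤ dim ker Φ″` (LEMMA 4), then the classes carried by `U′` — the image
of `ker Φ′` in `C₁ ⧸ B` — number at least `dim Z′ − dim T′ − (dim C₀ − i) − dim T_U`
(stated additively over `ℕ`). -/
theorem classes_lower_bound [FiniteDimensional K C₀] [FiniteDimensional K C₁] [FiniteDimensional K C₂]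
    (Φ'' : C₀ →ₗ[K] C₁) (Φ' : C₁ →ₗ[K] C₂) (B TU : Submodule K C₁)
    (Z' : Submodule K C₁) (T' : Submodule K C₂) (i : ℕ)
    (hB : LinearMap.ker Φ' ⊓ B ≤ LinearMap.range Φ'' ⊔ TU)
    (hZ : Z'.map Φ' ≤ T') (hi : i ≤ finrank K (LinearMap.ker Φ'')) :
    finrank K Z' + i ≤
      finrank K ↥((LinearMap.ker Φ').map B.mkQ) + finrank K T' + finrank K C₀ + finrank K TU := by
  have h1 := finrank_le_finrank_map_mkQ_add (LinearMap.ker Φ') B (LinearMap.range Φ'' ⊔ TU) hB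
  have h2 := Submodule.finrank_add_le_finrank_add_finrank (LinearMap.range Φ'') TU
  have h3 := LinearMap.finrank_range_add_finrank_ker Φ''
  have h4 := finrank_le_finrank_ker_add Φ' Z' T' hZ
  omega

end LinearAlgebra

/-! ## §2 The g = 6 constants of UNIVERSAL-w5n62g16 §7 and the four bounds (integer arithmetic) -/

section Constants

/-- `h⁰(O_{Z_4}(7Θ)) = 9 120` and `h⁰(O_{Z_4}(8Θ)) = 13 080` for the complete intersection `Z_4` of
four generic theta translates on a ppav₆ (Koszul: `Σ_j (−1)^j C(4,j) (k−j)⁶`). -/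
theorem h0Z_four :
    (7 : ℤ) ^ 6 - 4 * 6 ^ 6 + 6 * 5 ^ 6 - 4 * 4 ^ 6 + 3 ^ 6 = 9120 ∧
    (8 : ℤ) ^ 6 - 4 * 7 ^ 6 + 6 * 6 ^ 6 - 4 * 5 ^ 6 + 4 ^ 6 = 13080 := by norm_num

/-- `hom(S_r, O(mΘ)) = r·(m+3)⁶ − [(m+4)⁶ − h⁰(O_{Z_r}((m+4)Θ))]` evaluated for `r = 4, 3, 2`,
`m = 3, 4`: `78 095, 221 532, 42 779, 124 343, 15 625, 46 656` — equal to the closed forms of record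
`6·5⁶ − 4·4⁶ + 3⁶`, `6·6⁶ − 4·5⁶ + 4⁶`, `3·5⁶ − 4⁶`, `3·6⁶ − 5⁶`, `5⁶`, `6⁶`. -/
theorem homS_values :
    (4 : ℤ) * 6 ^ 6 - (7 ^ 6 - 9120) = 78095 ∧ (6 : ℤ) * 5 ^ 6 - 4 * 4 ^ 6 + 3 ^ 6 = 78095 ∧
    (4 : ℤ) * 7 ^ 6 - (8 ^ 6 - 13080) = 221532 ∧ (6 : ℤ) * 6 ^ 6 - 4 * 5 ^ 6 + 4 ^ 6 = 221532 ∧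
    (3 : ℤ) * 6 ^ 6 - (7 ^ 6 - (7 ^ 6 - 3 * 6 ^ 6 + 3 * 5 ^ 6 - 4 ^ 6)) = 42779 ∧
      (3 : ℤ) * 5 ^ 6 - 4 ^ 6 = 42779 ∧
    (3 : ℤ) * 7 ^ 6 - (8 ^ 6 - (8 ^ 6 - 3 * 7 ^ 6 + 3 * 6 ^ 6 - 5 ^ 6)) = 124343 ∧
      (3 : ℤ) * 6 ^ 6 - 5 ^ 6 = 124343 ∧
    (2 : ℤ) * 6 ^ 6 - (7 ^ 6 - (7 ^ 6 - 2 * 6 ^ 6 + 5 ^ 6)) = 15625 ∧ (5 : ℤ) ^ 6 = 15625 ∧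
    (2 : ℤ) * 7 ^ 6 - (8 ^ 6 - (8 ^ 6 - 2 * 7 ^ 6 + 6 ^ 6)) = 46656 ∧ (6 : ℤ) ^ 6 = 46656 := by
  norm_num

/-- `dim Kos = 6·3⁶ − 4 = 4 370` (the Koszul 4-fans `Hom(S₄, E_{−1∕2})`), `dim I = 4·5⁶ − dim Kos =
58 130` (the span `Σ_k t_k·Hom(C′,B′_k)`), and the bound `rank Φ″ ≤ 5·7⁶ − dim I = 530 115`. -/
theorem dimI_values :
    (6 : ℤ) * 3 ^ 6 - 4 = 4370 ∧ (4 : ℤ) * 5 ^ 6 - 4370 = 58130 ∧ (5 : ℤ) * 7 ^ 6 - 58130 = 530115 := by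
  norm_num

/-- LEMMA 3 lower bounds for `dim ker Φ′` (note §3.2): four flanked members `622 289`; three flanked
+ one unflanked member carrying cross slots `647 189`; three flanked with the fourth displaced
`578 214`; the 2-co-fan `547 285`. -/
theorem kerPhi1_values :
    (4 : ℤ) * 78095 + 9 ^ 6 - 221532 = 622289 ∧
    (4 : ℤ) * (42779 + 6 ^ 6) + 9 ^ 6 - (124343 + 7 ^ 6) = 647189 ∧
    (4 : ℤ) * 42779 + 9 ^ 6 - 124343 = 578214 ∧
    (4 : ℤ) * 15625 + 9 ^ 6 - 46656 = 547285 := by norm_num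

/-- **THEOREM U, the numbers.** `N = (ker Φ′ bound) − (5·7⁶ − dim I) − 1 = 92 173 ∕ 117 073 ∕
48 098 ∕ 17 169` for the four structures; all positive, minimum `17 169` over the 81 residue shapes. -/
theorem theoremU_bounds :
    (622289 : ℤ) - 530115 - 1 = 92173 ∧ (647189 : ℤ) - 530115 - 1 = 117073 ∧
    (578214 : ℤ) - 530115 - 1 = 48098 ∧ (547285 : ℤ) - 530115 - 1 = 17169 ∧ (0 : ℤ) < 17169 := by
  norm_num

/-- What the form-blind bookkeeper printed for the same union (cocycles ≥ dim C¹_{U′} − dim C²_adj):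
`16·6⁶ + 9⁶ − 8·7⁶ = 336 745` — an undercount of `622 289 − 336 745 = 285 544`; its coboundary charge
`5·7⁶ = 588 245` overcounts by `58 130`. -/
theorem bookkeeper_numbers :
    (16 : ℤ) * 6 ^ 6 + 9 ^ 6 - 8 * 7 ^ 6 = 336745 ∧ (622289 : ℤ) - 336745 = 285544 ∧
    (5 : ℤ) * 7 ^ 6 = 588245 := by norm_num

end Constants

end UnionSlotCount

end Summit.Ventures.HSemireg
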